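import Summits.QuantumFields.QCD.Theorems.PauliWegnerSeaFMClosureUnquenchedSideWitnessC1Aux4

/-!
# Side witness, part 5: a flow on a side yields an invertible side matrix

Crux `FMClosureUnquenched` (stmt-QuantumFields-11512), line `von-mises-circles`, registered sub-goal
`c1_sideWitness : SideWitness`.

**Theorem** (`flow_sideWitness`, = registered `c1_sideWitness_aux5`).  Let `A ⊆ (ℤ/N)⁴` carry a flow:
out-edges `x ↦ σ i x = x + STEP (d i x) ∈ A` (`i = 0, 1`) with distinct labels, in-edges
`π j y = y + STEP (e j y)‾ ∈ A` with distinct labels, mutually inverse (`hπ`, `hin`) and antiparallel-free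
(`hanti`: no in-label of `x` is the reverse of an out-label of `x`).  Then for every bare mass `m₀`
some `SU(3)` lattice gauge field `U` has `det (sideMatrix A (wilsonD U m₀)) ≠ 0`.

*Proof.*  Put link exponents `+1` along the flow, `-1` against it (well defined by `hanti`); the hop
exponents are then `+1` exactly on flow edges and `-1` exactly on reversed flow edges, so the flow
matrix is nonsingular (Aux3); by polynomial rigidity (Aux2) the row-scaled twisted side matrix
(a polynomial matrix in the twist, Aux4) is nonsingular at some twist `t` on the unit circle, and
`det (R · S) = det R · det S` finishes.
-/

namespace Summit.QuantumFields.QCD.Theorems.VonMisesCirclesC1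

open Matrix Literature.MathematicalPhysics.QuantumLattice Literature.Probability.LatticeModels
open Summit.QuantumFields.QCD.Theorems.VonMisesCircles Literature.MathematicalPhysics.QuantumFieldTheory
open scoped ComplexConjugate

set_option quotPrecheck false in
set_option hygiene false in
/-- The unit step `±e_μ` of label `ℓ = (μ, b)` on the torus `(ℤ/N)⁴`. -/
local notation "STEP" ℓ:arg =>
  (if Prod.snd ℓ then -(Pi.single (Prod.fst ℓ) 1 : TorusSite 4 N) else Pi.single (Prod.fst ℓ) 1)

set_option quotPrecheck false in
/-- The chiral hopping projector of label `ℓ`: `½(1 + γ_μ)` backward, `½(1 - γ_μ)` forward. -/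
local notation "PROJ" ℓ:arg =>
  (if Prod.snd ℓ then chiralProjPlus (Prod.fst ℓ) else chiralProjMinus (Prod.fst ℓ))

set_option quotPrecheck false in
/-- Exponent of `t` in the row-scaled twisted hop of signed link exponent `n` seen by colour `c`. -/
local notation "EXPF" c:arg n:arg =>
  (if n = (1 : ℤ) then (if c = (2 : Fin 3) then (4 : ℕ) else 0)
    else if n = (-1 : ℤ) then (if c = (2 : Fin 3) then (0 : ℕ) else 2)
    else (if c = (2 : Fin 3) then (2 : ℕ) else 1))

set_option quotPrecheck false in
set_option hygiene false in
/-- The signed link exponent seen by the hop `x → x + STEP ℓ` for the exponent field `a`. -/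
local notation "LEXP" a:arg x:arg ℓ:arg =>
  (if Prod.snd ℓ then -(a (x + STEP ℓ) (Prod.fst ℓ)) else a x (Prod.fst ℓ))

set_option quotPrecheck false in
set_option hygiene false in
/-- The `t^k`-coefficient of the row-scaled twisted side matrix (flow matrix for `k = 0`). -/
local notation "FLOWMAT" A:arg a:arg m₀:arg k:arg =>
  (Matrix.of fun (p q : QIdx N) =>
    if p.1 ∈ A ∧ q.1 ∈ A then
      (if p = q ∧ (if p.2.1 = (2 : Fin 3) then (2 : ℕ) else 1) = k then (((m₀ : ℝ) + 4 : ℝ) : ℂ) else 0) -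
        ∑ ℓ : Fin 4 × Bool, (if q.1 = p.1 + STEP ℓ ∧ p.2.1 = q.2.1 ∧ EXPF p.2.1 (LEXP a p.1 ℓ) = k
          then (PROJ ℓ) p.2.2 q.2.2 else 0)
    else (if p = q ∧ k = (0 : ℕ) then (1 : ℂ) else 0))

/-- **A flow on a side yields an invertible side matrix** (registered `c1_sideWitness_aux5`). -/
theorem flow_sideWitness {N : ℕ} [NeZero N] (A : Finset (TorusSite 4 N)) (m₀ : ℝ)
    (σ π : Fin 2 → TorusSite 4 N → TorusSite 4 N) (d e : Fin 2 → TorusSite 4 N → Fin 4 × Bool)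
    (hσ : ∀ x ∈ A, ∀ i : Fin 2, σ i x ∈ A ∧ σ i x = x + STEP (d i x))
    (hd : ∀ x ∈ A, d 0 x ≠ d 1 x)
    (hπ : ∀ y ∈ A, ∀ j : Fin 2, π j y ∈ A ∧ π j y = y + STEP ((e j y).1, !(e j y).2) ∧
      ∃ i : Fin 2, d i (π j y) = e j y)
    (he : ∀ y ∈ A, e 0 y ≠ e 1 y)
    (hin : ∀ x ∈ A, ∀ i : Fin 2, ∃ j : Fin 2, π j (σ i x) = x ∧ e j (σ i x) = d i x)
    (hanti : ∀ x ∈ A, ∀ i j : Fin 2, e j x ≠ ((d i x).1, !(d i x).2)) :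
    ∃ U : GaugeConfig 4 N (Matrix.specialUnitaryGroup (Fin 3) ℂ), (sideMatrix A (wilsonD U m₀)).det ≠ 0 := by
  -- the link-exponent field of the flow
  set a : TorusSite 4 N → Fin 4 → ℤ := fun x μ =>
    if x ∈ A ∧ (((μ, false) : Fin 4 × Bool) = d 0 x ∨ ((μ, false) : Fin 4 × Bool) = d 1 x) then 1
    else if x ∈ A ∧ (((μ, true) : Fin 4 × Bool) = e 0 x ∨ ((μ, true) : Fin 4 × Bool) = e 1 x) then -1
    else 0 with ha
  have hadef : ∀ x μ, a x μ =
      (if x ∈ A ∧ (((μ, false) : Fin 4 × Bool) = d 0 x ∨ ((μ, false) : Fin 4 × Bool) = d 1 x) then 1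
        else if x ∈ A ∧ (((μ, true) : Fin 4 × Bool) = e 0 x ∨ ((μ, true) : Fin 4 × Bool) = e 1 x) then -1
        else 0) := fun x μ => rfl
  have ha1 : ∀ x μ, a x μ = 1 ↔
      (x ∈ A ∧ (((μ, false) : Fin 4 × Bool) = d 0 x ∨ ((μ, false) : Fin 4 × Bool) = d 1 x)) := by
    intro x μ
    rw [hadef]
    by_cases h1 : x ∈ A ∧ (((μ, false) : Fin 4 × Bool) = d 0 x ∨ ((μ, false) : Fin 4 × Bool) = d 1 x)
    · rw [if_pos h1]; exact ⟨fun _ => h1, fun _ => rfl⟩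
    · by_cases h2 : x ∈ A ∧ (((μ, true) : Fin 4 × Bool) = e 0 x ∨ ((μ, true) : Fin 4 × Bool) = e 1 x)
      · rw [if_neg h1, if_pos h2]; exact ⟨fun h => absurd h (by decide), fun h => absurd h h1⟩
      · rw [if_neg h1, if_neg h2]; exact ⟨fun h => absurd h (by decide), fun h => absurd h h1⟩
  have ha2 : ∀ x μ, a x μ = -1 ↔
      (¬(x ∈ A ∧ (((μ, false) : Fin 4 × Bool) = d 0 x ∨ ((μ, false) : Fin 4 × Bool) = d 1 x)) ∧
        (x ∈ A ∧ (((μ, true) : Fin 4 × Bool) = e 0 x ∨ ((μ, true) : Fin 4 × Bool) = e 1 x))) := by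
    intro x μ
    rw [hadef]
    by_cases h1 : x ∈ A ∧ (((μ, false) : Fin 4 × Bool) = d 0 x ∨ ((μ, false) : Fin 4 × Bool) = d 1 x)
    · rw [if_pos h1]; exact ⟨fun h => absurd h (by decide), fun h => absurd h1 h.1⟩
    · by_cases h2 : x ∈ A ∧ (((μ, true) : Fin 4 × Bool) = e 0 x ∨ ((μ, true) : Fin 4 × Bool) = e 1 x)
      · rw [if_neg h1, if_pos h2]; exact ⟨fun _ => ⟨h1, h2⟩, fun _ => rfl⟩
      · rw [if_neg h1, if_neg h2]; exact ⟨fun h => absurd h (by decide), fun h => absurd h.2 h2⟩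
  -- no site has `(μ, false)` among its out-labels and `(μ, true)` among its in-labels
  have hexcl : ∀ x ∈ A, ∀ μ : Fin 4,
      (((μ, true) : Fin 4 × Bool) = e 0 x ∨ ((μ, true) : Fin 4 × Bool) = e 1 x) →
        ¬(x ∈ A ∧ (((μ, false) : Fin 4 × Bool) = d 0 x ∨ ((μ, false) : Fin 4 × Bool) = d 1 x)) := by
    intro x hx μ hμ h
    rcases h with ⟨-, h | h⟩ <;> rcases hμ with hμ | hμ
    · exact hanti x hx 0 0 (by rw [← hμ, ← h]; rfl)
    · exact hanti x hx 0 1 (by rw [← hμ, ← h]; rfl)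
    · exact hanti x hx 1 0 (by rw [← hμ, ← h]; rfl)
    · exact hanti x hx 1 1 (by rw [← hμ, ← h]; rfl)
  -- hop exponent `+1` exactly on the out-edges
  have hL1 : ∀ x ∈ A, ∀ ℓ : Fin 4 × Bool, (LEXP a x ℓ) = 1 ↔ (ℓ = d 0 x ∨ ℓ = d 1 x) := by
    intro x hx ℓ
    obtain ⟨μ, b⟩ := ℓ
    cases b
    · -- forward label: `a x μ = 1`
      simp only [Bool.false_eq_true, ite_false]
      rw [ha1]
      constructor
      · rintro ⟨-, h | h⟩
        · exact Or.inl h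
        · exact Or.inr h
      · rintro (h | h)
        · exact ⟨hx, Or.inl h⟩
        · exact ⟨hx, Or.inr h⟩
    · -- backward label: `-a (x - e_μ) μ = 1`
      simp only [ite_true]
      rw [neg_eq_iff_eq_neg, ha2]
      constructor
      · rintro ⟨-, hy, h⟩
        rcases h with h | h
        · obtain ⟨_, hπeq, i, hdi⟩ := hπ _ hy 0
          rw [← h] at hπeq hdi
          have hπx : π 0 (x + -(Pi.single μ 1 : TorusSite 4 N)) = x := by
            rw [hπeq]; simp
          rw [hπx] at hdi
          fin_cases i
          · exact Or.inl hdi.symm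
          · exact Or.inr hdi.symm
        · obtain ⟨_, hπeq, i, hdi⟩ := hπ _ hy 1
          rw [← h] at hπeq hdi
          have hπx : π 1 (x + -(Pi.single μ 1 : TorusSite 4 N)) = x := by
            rw [hπeq]; simp
          rw [hπx] at hdi
          fin_cases i
          · exact Or.inl hdi.symm
          · exact Or.inr hdi.symm
      · intro h
        have key : ∀ i : Fin 2, ((μ, true) : Fin 4 × Bool) = d i x →
            (x + -(Pi.single μ 1 : TorusSite 4 N)) ∈ A ∧
              (((μ, true) : Fin 4 × Bool) = e 0 (x + -(Pi.single μ 1 : TorusSite 4 N)) ∨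
                ((μ, true) : Fin 4 × Bool) = e 1 (x + -(Pi.single μ 1 : TorusSite 4 N))) := by
          intro i hdi
          have hσx : σ i x = x + -(Pi.single μ 1 : TorusSite 4 N) := by
            rw [(hσ x hx i).2, ← hdi]; simp
          refine ⟨hσx ▸ (hσ x hx i).1, ?_⟩
          obtain ⟨j, -, hej⟩ := hin x hx i
          rw [hσx, ← hdi] at hej
          fin_cases j
          · exact Or.inl hej.symm
          · exact Or.inr hej.symm
        have hy : (x + -(Pi.single μ 1 : TorusSite 4 N)) ∈ A ∧
            (((μ, true) : Fin 4 × Bool) = e 0 (x + -(Pi.single μ 1 : TorusSite 4 N)) ∨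
              ((μ, true) : Fin 4 × Bool) = e 1 (x + -(Pi.single μ 1 : TorusSite 4 N))) := by
          rcases h with h | h
          · exact key 0 h
          · exact key 1 h
        exact ⟨hexcl _ hy.1 μ hy.2, hy⟩
  -- hop exponent `-1` exactly on the reversed in-edges
  have hL2 : ∀ x ∈ A, ∀ ℓ : Fin 4 × Bool, (LEXP a x ℓ) = -1 ↔
      (ℓ = ((e 0 x).1, !(e 0 x).2) ∨ ℓ = ((e 1 x).1, !(e 1 x).2)) := by
    intro x hx ℓ
    obtain ⟨μ, b⟩ := ℓ
    cases b
    · -- forward label: `a x μ = -1`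
      simp only [Bool.false_eq_true, ite_false]
      rw [ha2]
      constructor
      · rintro ⟨-, -, h | h⟩
        · left; rw [← h]; rfl
        · right; rw [← h]; rfl
      · intro h
        have h' : ((μ, true) : Fin 4 × Bool) = e 0 x ∨ ((μ, true) : Fin 4 × Bool) = e 1 x := by
          rcases h with h | h
          · left
            simp only [Prod.mk.injEq] at h
            obtain ⟨h1, h2⟩ := h
            rw [Prod.ext_iff]; simp [h1, ← Bool.not_inj_iff, h2]
          · right
            simp only [Prod.mk.injEq] at h
            obtain ⟨h1, h2⟩ := h
            rw [Prod.ext_iff]; simp [h1, ← Bool.not_inj_iff, h2]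
        exact ⟨hexcl x hx μ h', hx, h'⟩
    · -- backward label: `-a (x - e_μ) μ = -1`
      simp only [ite_true]
      rw [neg_inj, ha1]
      constructor
      · rintro ⟨hy, h⟩
        have key : ∀ k : Fin 2, ((μ, false) : Fin 4 × Bool) = d k (x + -(Pi.single μ 1 : TorusSite 4 N)) →
            ((μ, true) : Fin 4 × Bool) = ((e 0 x).1, !(e 0 x).2) ∨
              ((μ, true) : Fin 4 × Bool) = ((e 1 x).1, !(e 1 x).2) := by
          intro k hdk
          have hσy : σ k (x + -(Pi.single μ 1 : TorusSite 4 N)) = x := by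
            rw [(hσ _ hy k).2, ← hdk]; simp
          obtain ⟨j, -, hej⟩ := hin _ hy k
          rw [hσy, ← hdk] at hej
          fin_cases j
          · left; simp only [Fin.zero_eta] at hej; rw [hej]; rfl
          · right; simp only [Fin.mk_one] at hej; rw [hej]; rfl
        rcases h with h | h
        · exact key 0 h
        · exact key 1 h
      · intro h
        have key : ∀ j : Fin 2, ((μ, true) : Fin 4 × Bool) = ((e j x).1, !(e j x).2) →
            (x + -(Pi.single μ 1 : TorusSite 4 N)) ∈ A ∧
              (((μ, false) : Fin 4 × Bool) = d 0 (x + -(Pi.single μ 1 : TorusSite 4 N)) ∨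
                ((μ, false) : Fin 4 × Bool) = d 1 (x + -(Pi.single μ 1 : TorusSite 4 N))) := by
          intro j hj
          have hej : e j x = ((μ, false) : Fin 4 × Bool) := by
            rw [Prod.ext_iff] at hj ⊢
            simp only at hj ⊢
            refine ⟨hj.1.symm, ?_⟩
            have := hj.2
            revert this
            cases (e j x).2 <;> simp
          obtain ⟨hπA, hπeq, i, hdi⟩ := hπ x hx j
          rw [hej] at hπeq hdi
          have hπx : π j x = x + -(Pi.single μ 1 : TorusSite 4 N) := by rw [hπeq]; simp
          rw [hπx] at hπA hdi
          refine ⟨hπA, ?_⟩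
          fin_cases i
          · exact Or.inl hdi.symm
          · exact Or.inr hdi.symm
        rcases h with h | h
        · exact key 0 h
        · exact key 1 h
  -- the flow matrix is nonsingular, hence so is the twisted side matrix at some twist
  have h0 := det_flowMatrix_ne_zero A m₀ a σ π d e hσ hd hπ he hin hL1 hL2
  obtain ⟨t, ht, hdet⟩ := exists_circle_det_ne_zero _ _ _ _ h0
  obtain ⟨g, hg⟩ := exists_su3_diag ht
  refine ⟨fun ed => if a ed.1 ed.2 = 1 then g else if a ed.1 ed.2 = -1 then g⁻¹ else 1, fun hz => ?_⟩
  have hent := congrArg Matrix.det (rowScaled_sideMatrix_eq A m₀ a ht g hg)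
  rw [Matrix.det_mul, hz, mul_zero] at hent
  exact hdet hent.symm

/-- **Registered helper `c1_sideWitness_aux5` of crux stmt-QuantumFields-11512** (line `von-mises-circles`,
sub-goal `c1_sideWitness`): a flow on a side yields an invertible side matrix. -/
theorem c1_sideWitness_aux5 : ∀ (N : ℕ) [NeZero N] (A : Finset (TorusSite 4 N)) (m₀ : ℝ) (σ π : Fin 2 → TorusSite 4 N → TorusSite 4 N) (d e : Fin 2 → TorusSite 4 N → Fin 4 × Bool), (∀ x ∈ A, ∀ i : Fin 2, σ i x ∈ A ∧ σ i x = x + (if Prod.snd (d i x) then -(Pi.single (Prod.fst (d i x)) 1 : TorusSite 4 N) else Pi.single (Prod.fst (d i x)) 1)) → (∀ x ∈ A, d 0 x ≠ d 1 x) → (∀ y ∈ A, ∀ j : Fin 2, π j y ∈ A ∧ π j y = y + (if Prod.snd ((e j y).1, !(e j y).2) then -(Pi.single (Prod.fst ((e j y).1, !(e j y).2)) 1 : TorusSite 4 N) else Pi.single (Prod.fst ((e j y).1, !(e j y).2)) 1) ∧ ∃ i : Fin 2, d i (π j y) = e j y) → (∀ y ∈ A, e 0 y ≠ e 1 y) →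 (∀ x ∈ A, ∀ i : Fin 2, ∃ j : Fin 2, π j (σ i x) = x ∧ e j (σ i x) = d i x) → (∀ x ∈ A, ∀ i j : Fin 2, e j x ≠ ((d i x).1, !(d i x).2)) → ∃ U : GaugeConfig 4 N (Matrix.specialUnitaryGroup (Fin 3) ℂ), (sideMatrix A (wilsonD U m₀)).det ≠ 0 :=
  fun _ _ A m₀ σ π d e hσ hd hπ he hin hanti => flow_sideWitness A m₀ σ π d e hσ hd hπ he hin hanti

end Summit.QuantumFields.QCD.Theorems.VonMisesCirclesC1
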